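import Mathlib
import Summits.Ventures.FusionMHD.Models.CerfonFreidbergIterLikeQHalfGradBoxes
import HarnessLib

/-!
# Ventures/FusionMHD — Models/CerfonFreidbergIterLikeQHalfGradBoxes2.lean: KERNEL CHECK of the per-panel `∂_s G` boxes of panels 16–31 (of 32)
# at `ψ_N = 1/2` of THE Cerfon–Freidberg ITER-like instance

HONEST FRAMING (LADDER-GRIDFUSION three columns; CF rung; «F2.R2-CF-MERCIER-IMPLICIT» step (4)).  Sixteen `decide +kernel`s (natural interval extension of
the code list `GsS` over `gBox k`, ≈ 3 s each as separate theorems — a single bounded-`∀` decide of the same sixteen costs minutes): `|∂_s G| ≤ MGP k` on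
each box.  MODELLED: analytic Cerfon–Freidberg family; nothing about a device or stability.  No `native_decide`.  Typer/prover: gridfusion-model-7 (g7),
2026-08-27.  Citations: Moore 1979 §4.3 (4.21) [Moore1979].
-/

namespace Summit.Ventures.FusionMHD.Models.CFIterLike.QHalf

/-- **KERNEL CHECK** of the `∂_s G` box of panel 16. -/
theorem gsok1_16 : gsok1 16 = true := by decide +kernel

/-- **KERNEL CHECK** of the `∂_s G` box of panel 17. -/
theorem gsok1_17 : gsok1 17 = true := by decide +kernel

/-- **KERNEL CHECK** of the `∂_s G` box of panel 18. -/
theorem gsok1_18 : gsok1 18 = true := by decide +kernel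

/-- **KERNEL CHECK** of the `∂_s G` box of panel 19. -/
theorem gsok1_19 : gsok1 19 = true := by decide +kernel

/-- **KERNEL CHECK** of the `∂_s G` box of panel 20. -/
theorem gsok1_20 : gsok1 20 = true := by decide +kernel

/-- **KERNEL CHECK** of the `∂_s G` box of panel 21. -/
theorem gsok1_21 : gsok1 21 = true := by decide +kernel

/-- **KERNEL CHECK** of the `∂_s G` box of panel 22. -/
theorem gsok1_22 : gsok1 22 = true := by decide +kernel

/-- **KERNEL CHECK** of the `∂_s G` box of panel 23. -/
theorem gsok1_23 : gsok1 23 = true := by decide +kernel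

/-- **KERNEL CHECK** of the `∂_s G` box of panel 24. -/
theorem gsok1_24 : gsok1 24 = true := by decide +kernel

/-- **KERNEL CHECK** of the `∂_s G` box of panel 25. -/
theorem gsok1_25 : gsok1 25 = true := by decide +kernel

/-- **KERNEL CHECK** of the `∂_s G` box of panel 26. -/
theorem gsok1_26 : gsok1 26 = true := by decide +kernel

/-- **KERNEL CHECK** of the `∂_s G` box of panel 27. -/
theorem gsok1_27 : gsok1 27 = true := by decide +kernel

/-- **KERNEL CHECK** of the `∂_s G` box of panel 28. -/
theorem gsok1_28 : gsok1 28 = true := by decide +kernel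

/-- **KERNEL CHECK** of the `∂_s G` box of panel 29. -/
theorem gsok1_29 : gsok1 29 = true := by decide +kernel

/-- **KERNEL CHECK** of the `∂_s G` box of panel 30. -/
theorem gsok1_30 : gsok1 30 = true := by decide +kernel

/-- **KERNEL CHECK** of the `∂_s G` box of panel 31. -/
theorem gsok1_31 : gsok1 31 = true := by decide +kernel

end Summit.Ventures.FusionMHD.Models.CFIterLike.QHalf
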